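import Summits.QuantumFields.BalabanUV.T4Continuum.Support.NE7ExpLogSecondOrder
import Summits.QuantumFields.BalabanUV.T4Continuum.Support.UnitaryGeodesic
import HarnessLib

/-!
# T⁴ programme, row NE7 — (154b) THE TWO-POINT GEODESIC TO SECOND ORDER IN ITS ENDPOINTS: `geo s b₀ b₁ = (1−s)b₀ + s b₁ +
# b₀·F_s(b₀⁻¹b₁)` with `F_s(R) = R^s − 1 − s(R − 1)` quadratically small (`NE7GeodesicSecondOrder`)

Cell `pub-balaban`, lineage `t4-ne7-p2` (CRUX PROVER NE7 #2), gen 86; second file of the kernel chain (154) (road (β′): the C²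
corner-gauge interpolation striking THE END's `hflatTop`).  The interpolant of (154) is assembled direction by direction from
the tree's two-point geodesic `geo s b₀ b₁ = b₀·(b₀⁻¹b₁)^s` (`UnitaryGeodesic`, `UnitaryRootInterpolation.upow s R =
exp (s • log R)`) sampled at smoothstep parameters; the control of the interpolant's FIRST and SECOND lattice differences
across already-interpolated directions rests on the decomposition (exact)
  `geo s b₀ b₁ = b₀ + s•(b₁ − b₀) + b₀·F_s(b₀⁻¹b₁)`,  `F_s(R) := R^s − 1 − s•(R − 1) = T(s•log R) + s•(log R − (R − 1))`
(`T x = eˣ − 1 − x`), whose affine part carries the endpoint data LINEARLY (so with constant `(1−s) + s = 1`, no loss per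
direction) and whose remainder `F_s` is `O(sρ)`-Lipschitz with `O(sρ)`-small second differences (by (154a)).
§1 `F_s` on `‖R − 1‖ ≤ ρ ≤ 1∕4`, `0 ≤ s ≤ 1`: SIZE `‖F_s(R)‖ ≤ 5sρ`, LIPSCHITZ `‖F_s(R′) − F_s(R)‖ ≤ 7sρ‖R′ − R‖`, SECOND
DIFFERENCES `‖pg F_s(R)‖ ≤ s(24ρ·δ_R + 24·l_R m_R)`;
§2 unitary endpoints in a C⋆-algebra: the decomposition, the SHARP FIRST-DIFFERENCE bound
`‖geo s b₀′ b₁′ − geo s b₀ b₁‖ ≤ (1−s)‖b₀′−b₀‖ + s‖b₁′−b₁‖ + 12sρ(‖b₀′−b₀‖ + ‖b₁′−b₁‖)` and the SHARP SECOND-DIFFERENCE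
bound over a lattice parallelogram of endpoints `‖pg geo‖ ≤ σ + s(53ρ·σ + 115·l·m)` (sides `l, m`, `‖pg bₑ‖ ≤ σ`, `e = 0,1`);
(The parameter direction — steps in `s` — is the sequel `NE7GeodesicParameter`.)

HONEST FRAMING (page 1): [folklore] Banach-∕C⋆-algebra calculus over (154a) and the tree's `UnitaryGeodesic`; constants are
the file's, not optimised; `pg a₁ a₂ a₃ a₄ := a₄ − a₃ − a₂ + a₁` in docstrings only (statements written out).  Nothing of
Bałaban's; nothing about gauge fields yet; (APE) NOT proved; NE7 NOT PRINTED ∕ NOT PROVED; spine 0∕9; finite T⁴ rung (B)+1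
— NOT infinite volume, NOT mass gap, NOT Clay.  No `sorry`.  PLACEMENT: our lemma, under `Summits/QuantumFields/BalabanUV/`.
Continuum YM on T⁴ ⇐ BetaPertH ∧ nine spine estimates (0/9 proved); BetaPertH ⇐ (D1) ∧ (D4) ∧ CAP+tail; G-an2-4 gates asym, D1 and NE2/3/4.
-/

set_option autoImplicit false

open NormedSpace

namespace Summit.QuantumFields.BalabanUV.T4Continuum.NE7GeodesicSecondOrder

open Literature.MathematicalPhysics.QuantumFieldTheory.Balaban1983to89
open MatrixLog B7Prop1Explicit B7Prop2Explicit UnitaryRootInterpolation UnitaryGeodesic NE7ExpLogSecondOrder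

noncomputable section

/-! ## §1 The remainder `F_s(R) = R^s − 1 − s•(R − 1)` -/

section Remainder

variable {𝔸 : Type*} [NormedRing 𝔸] [NormedAlgebra ℂ 𝔸] [CompleteSpace 𝔸] [NormOneClass 𝔸]

omit [CompleteSpace 𝔸] [NormOneClass 𝔸] in
/-- `F_s(R) = T(s • log R) + s • (log R − (R − 1))` with `T x = eˣ − 1 − x`. [folklore] -/
theorem upow_sub_one_sub_eq (s : ℝ) (R : 𝔸) :
    upow s R - 1 - s • (R - 1) = (exp (s • mlog R) - 1 - s • mlog R) + s • (mlog R - (R - 1)) := by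
  simp only [upow_def, smul_sub]; abel

omit [NormOneClass 𝔸] in
/-- **SIZE**: `‖F_s(R)‖ ≤ 5sρ` on `‖R − 1‖ ≤ ρ ≤ 1∕4`, `0 ≤ s ≤ 1`. [folklore] -/
theorem norm_upow_sub_one_sub_le {R : 𝔸} {ρ s : ℝ} (hR : ‖R - 1‖ ≤ ρ) (hρ : ρ ≤ 1 / 4) (hs0 : 0 ≤ s) (hs1 : s ≤ 1) :
    ‖upow s R - 1 - s • (R - 1)‖ ≤ 5 * s * ρ := by
  have hρ0 : 0 ≤ ρ := (norm_nonneg _).trans hR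
  have h1 : ‖upow s R - 1‖ ≤ 4 * |s| * ρ :=
    norm_upow_sub_one_le_lin hR (by linarith) (by rw [abs_of_nonneg hs0]; nlinarith)
  rw [abs_of_nonneg hs0] at h1
  have h2 : ‖s • (R - 1)‖ ≤ s * ρ := by
    rw [norm_smul, Real.norm_eq_abs, abs_of_nonneg hs0]; exact mul_le_mul_of_nonneg_left hR hs0
  calc ‖upow s R - 1 - s • (R - 1)‖ ≤ ‖upow s R - 1‖ + ‖s • (R - 1)‖ := norm_sub_le _ _
    _ ≤ 4 * s * ρ + s * ρ := add_le_add h1 h2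
    _ = 5 * s * ρ := by ring

/-- **LIPSCHITZ**: `‖F_s(R′) − F_s(R)‖ ≤ 7sρ‖R′ − R‖` on `‖R − 1‖, ‖R′ − 1‖ ≤ ρ ≤ 1∕4`, `0 ≤ s ≤ 1` (the exponential tail is
`(e^{2sρ} − 1) ≤ 4sρ`-Lipschitz on `‖·‖ ≤ 2sρ`, the logarithm `4∕3`-Lipschitz and `log R − (R−1)` `ρ∕(1−ρ) ≤ 4ρ∕3`-Lipschitz).
[folklore] -/
theorem norm_upow_rem_sub_le {R R' : 𝔸} {ρ s : ℝ} (hR : ‖R - 1‖ ≤ ρ) (hR' : ‖R' - 1‖ ≤ ρ) (hρ : ρ ≤ 1 / 4)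
    (hs0 : 0 ≤ s) (hs1 : s ≤ 1) :
    ‖(upow s R' - 1 - s • (R' - 1)) - (upow s R - 1 - s • (R - 1))‖ ≤ 7 * s * ρ * ‖R' - R‖ := by
  have hρ0 : 0 ≤ ρ := (norm_nonneg _).trans hR
  rw [upow_sub_one_sub_eq, upow_sub_one_sub_eq]
  have hX : ∀ {G : 𝔸}, ‖G - 1‖ ≤ ρ → ‖s • mlog G‖ ≤ s * (2 * ρ) := fun h => by
    rw [norm_smul, Real.norm_eq_abs, abs_of_nonneg hs0]
    exact mul_le_mul_of_nonneg_left (norm_mlog_le_of_le h hρ) hs0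
  -- tail part
  have hT := norm_expTail_sub_expTail_le (hX hR') (hX hR)
  have he : Real.exp (s * (2 * ρ)) - 1 ≤ 2 * (s * (2 * ρ)) :=
    real_exp_sub_one_le_two_mul (by positivity) (by nlinarith)
  have hXX : ‖s • mlog R' - s • mlog R‖ ≤ s * (4 / 3 * ‖R' - R‖) := by
    rw [← smul_sub, norm_smul, Real.norm_eq_abs, abs_of_nonneg hs0]
    exact mul_le_mul_of_nonneg_left (norm_mlog_sub_mlog_le_four_thirds hρ hR' hR) hs0
  -- logarithm remainder part (tree)
  have hN := FederbushMean.norm_mlog_sub_mlog_sub_le (hρ.trans_lt (by norm_num)) hR' hR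
  have hdiv : ρ / (1 - ρ) ≤ 4 / 3 * ρ := by
    rw [div_le_iff₀ (by linarith)]; nlinarith
  have hN' : ‖s • (mlog R' - (R' - 1)) - s • (mlog R - (R - 1))‖ ≤ s * (4 / 3 * ρ * ‖R' - R‖) := by
    rw [← smul_sub, norm_smul, Real.norm_eq_abs, abs_of_nonneg hs0]
    refine mul_le_mul_of_nonneg_left ?_ hs0
    have : mlog R' - (R' - 1) - (mlog R - (R - 1)) = mlog R' - mlog R - (R' - R) := by abel
    rw [this]
    exact hN.trans (mul_le_mul_of_nonneg_right hdiv (norm_nonneg _))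
  calc ‖exp (s • mlog R') - 1 - s • mlog R' + s • (mlog R' - (R' - 1))
        - (exp (s • mlog R) - 1 - s • mlog R + s • (mlog R - (R - 1)))‖
      = ‖(exp (s • mlog R') - 1 - s • mlog R' - (exp (s • mlog R) - 1 - s • mlog R))
          + (s • (mlog R' - (R' - 1)) - s • (mlog R - (R - 1)))‖ := by congr 1; abel
    _ ≤ (Real.exp (s * (2 * ρ)) - 1) * ‖s • mlog R' - s • mlog R‖ + s * (4 / 3 * ρ * ‖R' - R‖) :=
        (norm_add_le _ _).trans (add_le_add hT hN')
    _ ≤ 2 * (s * (2 * ρ)) * (s * (4 / 3 * ‖R' - R‖)) + s * (4 / 3 * ρ * ‖R' - R‖) := by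
        gcongr
    _ = s * ρ * ‖R' - R‖ * (16 / 3 * s + 4 / 3) := by ring
    _ ≤ s * ρ * ‖R' - R‖ * 7 := by gcongr; linarith
    _ = 7 * s * ρ * ‖R' - R‖ := by ring

/-- **SECOND DIFFERENCES**: over four points `Rᵢ` with `‖Rᵢ − 1‖ ≤ ρ ≤ 1∕4`, sides `l, m` and `‖pg R‖ ≤ δ`, for `0 ≤ s ≤ 1`:
`‖pg F_s(R)‖ ≤ s·(24ρ·δ + 24·l·m)` ((154a) for the tail at `s • log Rᵢ` and for `log R − (R − 1)`). [folklore] -/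
theorem norm_pg_upow_rem_le {R₁ R₂ R₃ R₄ : 𝔸} {ρ l m δ s : ℝ} (hρ : ρ ≤ 1 / 4)
    (h₁ : ‖R₁ - 1‖ ≤ ρ) (h₂ : ‖R₂ - 1‖ ≤ ρ) (h₃ : ‖R₃ - 1‖ ≤ ρ) (h₄ : ‖R₄ - 1‖ ≤ ρ)
    (h12 : ‖R₂ - R₁‖ ≤ l) (h34 : ‖R₄ - R₃‖ ≤ l) (h13 : ‖R₃ - R₁‖ ≤ m) (h24 : ‖R₄ - R₂‖ ≤ m)
    (hδ : ‖R₄ - R₃ - R₂ + R₁‖ ≤ δ) (hs0 : 0 ≤ s) (hs1 : s ≤ 1) :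
    ‖(upow s R₄ - 1 - s • (R₄ - 1)) - (upow s R₃ - 1 - s • (R₃ - 1)) - (upow s R₂ - 1 - s • (R₂ - 1))
        + (upow s R₁ - 1 - s • (R₁ - 1))‖ ≤ s * (24 * ρ * δ + 24 * (l * m)) := by
  have hρ0 : 0 ≤ ρ := (norm_nonneg _).trans h₁
  have hl0 : 0 ≤ l := (norm_nonneg _).trans h12
  have hm0 : 0 ≤ m := (norm_nonneg _).trans h13
  have hδ0 : 0 ≤ δ := (norm_nonneg _).trans hδ
  simp only [upow_sub_one_sub_eq]
  -- the logarithms `Xᵢ`, scaled by `s`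
  have hX : ∀ {G : 𝔸}, ‖G - 1‖ ≤ ρ → ‖s • mlog G‖ ≤ s * (2 * ρ) := fun h => by
    rw [norm_smul, Real.norm_eq_abs, abs_of_nonneg hs0]
    exact mul_le_mul_of_nonneg_left (norm_mlog_le_of_le h hρ) hs0
  have hL : ∀ {A B : 𝔸} {t : ℝ}, ‖A - 1‖ ≤ ρ → ‖B - 1‖ ≤ ρ → ‖A - B‖ ≤ t →
      ‖s • mlog A - s • mlog B‖ ≤ s * (4 / 3 * t) := fun hA hB ht => by
    rw [← smul_sub, norm_smul, Real.norm_eq_abs, abs_of_nonneg hs0]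
    exact mul_le_mul_of_nonneg_left ((norm_mlog_sub_mlog_le_four_thirds hρ hA hB).trans (by gcongr)) hs0
  have hpgX : ‖mlog R₄ - mlog R₃ - mlog R₂ + mlog R₁‖ ≤ 3 * δ + 9 * (l * m) :=
    norm_pg_mlog_le hρ h₁ h₂ h₃ h₄ h12 h34 h13 h24 hδ
  have hpgsX : ‖s • mlog R₄ - s • mlog R₃ - s • mlog R₂ + s • mlog R₁‖ ≤ s * (3 * δ + 9 * (l * m)) := by
    rw [← smul_sub, ← smul_sub, ← smul_add, norm_smul, Real.norm_eq_abs, abs_of_nonneg hs0]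
    exact mul_le_mul_of_nonneg_left hpgX hs0
  -- (154a) for the tail
  have hT := norm_pg_expTail_le (hX h₁) (hX h₂) (hX h₃) (hX h₄) (hL h₂ h₁ h12) (hL h₄ h₃ h34) (hL h₃ h₁ h13)
    (hL h₄ h₂ h24) hpgsX
  -- (154a) for `log R − (R − 1)`
  have hN := norm_pg_mlog_sub_pg_le hρ h₁ h₂ h₃ h₄ h12 h34 h13 h24 hδ
  have hN' : ‖s • (mlog R₄ - (R₄ - 1)) - s • (mlog R₃ - (R₃ - 1)) - s • (mlog R₂ - (R₂ - 1)) + s • (mlog R₁ - (R₁ - 1))‖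
      ≤ s * (12 * ρ * δ + 12 * (l * m)) := by
    rw [← smul_sub, ← smul_sub, ← smul_add, norm_smul, Real.norm_eq_abs, abs_of_nonneg hs0]
    refine mul_le_mul_of_nonneg_left ?_ hs0
    have : mlog R₄ - (R₄ - 1) - (mlog R₃ - (R₃ - 1)) - (mlog R₂ - (R₂ - 1)) + (mlog R₁ - (R₁ - 1))
        = (mlog R₄ - mlog R₃ - mlog R₂ + mlog R₁) - (R₄ - R₃ - R₂ + R₁) := by abel
    rw [this]; exact hN
  -- numerics
  have he1 : Real.exp (s * (2 * ρ)) - 1 ≤ 2 * (s * (2 * ρ)) := real_exp_sub_one_le_two_mul (by positivity) (by nlinarith)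
  have he : Real.exp (s * (2 * ρ)) ≤ 5 / 3 :=
    (Real.exp_le_exp.mpr (by nlinarith)).trans (real_exp_two_mul_le hρ)
  have hlm : 0 ≤ l * m := mul_nonneg hl0 hm0
  calc ‖exp (s • mlog R₄) - 1 - s • mlog R₄ + s • (mlog R₄ - (R₄ - 1))
        - (exp (s • mlog R₃) - 1 - s • mlog R₃ + s • (mlog R₃ - (R₃ - 1)))
        - (exp (s • mlog R₂) - 1 - s • mlog R₂ + s • (mlog R₂ - (R₂ - 1)))
        + (exp (s • mlog R₁) - 1 - s • mlog R₁ + s • (mlog R₁ - (R₁ - 1)))‖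
      = ‖(exp (s • mlog R₄) - 1 - s • mlog R₄ - (exp (s • mlog R₃) - 1 - s • mlog R₃)
            - (exp (s • mlog R₂) - 1 - s • mlog R₂) + (exp (s • mlog R₁) - 1 - s • mlog R₁))
          + (s • (mlog R₄ - (R₄ - 1)) - s • (mlog R₃ - (R₃ - 1)) - s • (mlog R₂ - (R₂ - 1))
            + s • (mlog R₁ - (R₁ - 1)))‖ := by congr 1; abel
    _ ≤ ((Real.exp (s * (2 * ρ)) - 1) * (s * (3 * δ + 9 * (l * m)))
          + Real.exp (s * (2 * ρ)) * (s * (4 / 3 * l) * (s * (4 / 3 * m)))) + s * (12 * ρ * δ + 12 * (l * m)) :=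
        (norm_add_le _ _).trans (add_le_add hT hN')
    _ ≤ (2 * (s * (2 * ρ)) * (s * (3 * δ + 9 * (l * m))) + 5 / 3 * (s * (4 / 3 * l) * (s * (4 / 3 * m))))
          + s * (12 * ρ * δ + 12 * (l * m)) := by
        gcongr
    _ = s * (12 * ρ * δ * s + 12 * ρ * δ + (36 * ρ * s + 80 / 27 * s + 12) * (l * m)) := by ring
    _ ≤ s * (24 * ρ * δ + 24 * (l * m)) := by
        refine mul_le_mul_of_nonneg_left ?_ hs0
        have h1 : 12 * ρ * δ * s ≤ 12 * ρ * δ := by nlinarith [mul_nonneg hρ0 hδ0]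
        have h2 : (36 * ρ * s + 80 / 27 * s + 12) * (l * m) ≤ 24 * (l * m) := by
          refine mul_le_mul_of_nonneg_right ?_ hlm; nlinarith
        linarith

end Remainder

/-! ## §2 The geodesic between unitaries to second order in the endpoints -/

section UnitaryGeo

variable {𝔸 : Type*} [CStarAlgebra 𝔸] [Nontrivial 𝔸]

omit [Nontrivial 𝔸] in
/-- Differences of inverses of unitaries have the norm of the differences (the inverse of a unitary unit is its adjoint —
tree `ChainEndFix.val_inv_eq_star`, restated inline to keep the imports light). [folklore] -/
theorem norm_inv_sub_inv {u v : 𝔸ˣ} (hu : u ∈ unitaryUnits 𝔸) (hv : v ∈ unitaryUnits 𝔸) :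
    ‖((u⁻¹ : 𝔸ˣ) : 𝔸) - ((v⁻¹ : 𝔸ˣ) : 𝔸)‖ = ‖(u : 𝔸) - v‖ := by
  have eu : ((u⁻¹ : 𝔸ˣ) : 𝔸) = star (u : 𝔸) :=
    Units.inv_eq_of_mul_eq_one_right (Unitary.mul_star_self_of_mem (mem_unitaryUnits.mp hu))
  have ev : ((v⁻¹ : 𝔸ˣ) : 𝔸) = star (v : 𝔸) :=
    Units.inv_eq_of_mul_eq_one_right (Unitary.mul_star_self_of_mem (mem_unitaryUnits.mp hv))
  rw [eu, ev, ← star_sub, norm_star]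

omit [Nontrivial 𝔸] in
/-- Second differences of inverses of unitaries have the norm of the second differences. [folklore] -/
theorem norm_pg_inv {u₁ u₂ u₃ u₄ : 𝔸ˣ} (h₁ : u₁ ∈ unitaryUnits 𝔸) (h₂ : u₂ ∈ unitaryUnits 𝔸)
    (h₃ : u₃ ∈ unitaryUnits 𝔸) (h₄ : u₄ ∈ unitaryUnits 𝔸) :
    ‖((u₄⁻¹ : 𝔸ˣ) : 𝔸) - ((u₃⁻¹ : 𝔸ˣ) : 𝔸) - ((u₂⁻¹ : 𝔸ˣ) : 𝔸) + ((u₁⁻¹ : 𝔸ˣ) : 𝔸)‖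
      = ‖(u₄ : 𝔸) - u₃ - u₂ + u₁‖ := by
  have e : ∀ {u : 𝔸ˣ}, u ∈ unitaryUnits 𝔸 → ((u⁻¹ : 𝔸ˣ) : 𝔸) = star (u : 𝔸) := fun hu =>
    Units.inv_eq_of_mul_eq_one_right (Unitary.mul_star_self_of_mem (mem_unitaryUnits.mp hu))
  rw [e h₁, e h₂, e h₃, e h₄, ← star_sub, ← star_sub, ← star_add, norm_star]

omit [Nontrivial 𝔸] in
/-- **THE DECOMPOSITION** `geo s b₀ b₁ = b₀ + s•(b₁ − b₀) + b₀·F_s(b₀⁻¹b₁)` (exact; `b₀·(b₀⁻¹b₁ − 1) = b₁ − b₀`). [folklore] -/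
theorem geo_eq_affine_add (s : ℝ) (b₀ b₁ : 𝔸ˣ) :
    (geo s b₀ b₁ : 𝔸) = (b₀ : 𝔸) + s • ((b₁ : 𝔸) - b₀)
      + (b₀ : 𝔸) * (upow s ((b₀⁻¹ * b₁ : 𝔸ˣ) : 𝔸) - 1 - s • (((b₀⁻¹ * b₁ : 𝔸ˣ) : 𝔸) - 1)) := by
  rw [geo_def, Units.val_mul, val_upowUnit]
  have h : (b₀ : 𝔸) * (((b₀⁻¹ * b₁ : 𝔸ˣ) : 𝔸) - 1) = (b₁ : 𝔸) - b₀ := by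
    rw [mul_sub, Units.val_mul, Units.mul_inv_cancel_left, mul_one]
  rw [mul_sub, mul_sub, mul_smul_comm, h, mul_one]
  abel

omit [Nontrivial 𝔸] in
/-- The ratio is as close to `1` as the endpoints are to each other (tree `norm_ratio_sub_one`). [folklore] -/
theorem norm_ratio_sub_one_le {b₀ b₁ : 𝔸ˣ} (h₀ : b₀ ∈ unitaryUnits 𝔸) {ρ : ℝ} (h : ‖(b₁ : 𝔸) - b₀‖ ≤ ρ) :
    ‖((b₀⁻¹ * b₁ : 𝔸ˣ) : 𝔸) - 1‖ ≤ ρ := by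
  rw [norm_ratio_sub_one h₀]; exact h

/-- **SHARP FIRST-DIFFERENCE BOUND**: for unitaries with `‖b₁ − b₀‖, ‖b₁′ − b₀′‖ ≤ ρ ≤ 1∕4` and `0 ≤ s ≤ 1`,
`‖geo s b₀′ b₁′ − geo s b₀ b₁‖ ≤ (1−s)‖b₀′−b₀‖ + s‖b₁′−b₁‖ + 12sρ·(‖b₀′−b₀‖ + ‖b₁′−b₁‖)` — the affine part moves the endpoints
with total weight `1`, the remainder costs `O(sρ)`. [folklore] -/
theorem norm_geo_sub_geo_sharp {b₀ b₁ b₀' b₁' : 𝔸ˣ} (h₀ : b₀ ∈ unitaryUnits 𝔸) (h₁ : b₁ ∈ unitaryUnits 𝔸)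
    (h₀' : b₀' ∈ unitaryUnits 𝔸) {ρ s : ℝ} (hρ : ρ ≤ 1 / 4)
    (hb : ‖(b₁ : 𝔸) - b₀‖ ≤ ρ) (hb' : ‖(b₁' : 𝔸) - b₀'‖ ≤ ρ) (hs0 : 0 ≤ s) (hs1 : s ≤ 1) :
    ‖(geo s b₀' b₁' : 𝔸) - geo s b₀ b₁‖
      ≤ (1 - s) * ‖(b₀' : 𝔸) - b₀‖ + s * ‖(b₁' : 𝔸) - b₁‖ + 12 * s * ρ * (‖(b₀' : 𝔸) - b₀‖ + ‖(b₁' : 𝔸) - b₁‖) := by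
  have hρ0 : 0 ≤ ρ := (norm_nonneg _).trans hb
  obtain ⟨R, hRdef⟩ : ∃ R : 𝔸, R = ((b₀⁻¹ * b₁ : 𝔸ˣ) : 𝔸) := ⟨_, rfl⟩
  obtain ⟨R', hR'def⟩ : ∃ R' : 𝔸, R' = ((b₀'⁻¹ * b₁' : 𝔸ˣ) : 𝔸) := ⟨_, rfl⟩
  have hR : ‖R - 1‖ ≤ ρ := hRdef ▸ norm_ratio_sub_one_le h₀ hb
  have hR' : ‖R' - 1‖ ≤ ρ := hR'def ▸ norm_ratio_sub_one_le h₀' hb'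
  obtain ⟨F, hFdef⟩ : ∃ F : 𝔸, F = upow s R - 1 - s • (R - 1) := ⟨_, rfl⟩
  obtain ⟨F', hF'def⟩ : ∃ F' : 𝔸, F' = upow s R' - 1 - s • (R' - 1) := ⟨_, rfl⟩
  -- exact identity
  have hid : (geo s b₀' b₁' : 𝔸) - geo s b₀ b₁
      = ((1 - s) • ((b₀' : 𝔸) - b₀) + s • ((b₁' : 𝔸) - b₁)) + (((b₀' : 𝔸) - b₀) * F' + (b₀ : 𝔸) * (F' - F)) := by
    rw [geo_eq_affine_add, geo_eq_affine_add, ← hRdef, ← hR'def, ← hFdef, ← hF'def]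
    simp only [sub_smul, one_smul, smul_sub, sub_mul, mul_sub]
    abel
  have hRR : ‖R' - R‖ ≤ ‖(b₀' : 𝔸) - b₀‖ + ‖(b₁' : 𝔸) - b₁‖ := by
    rw [hRdef, hR'def]
    exact norm_ratio_sub_ratio_le (b₀ := b₀') (b₁ := b₁') (b₀' := b₀) (b₁' := b₁) h₀' h₀ h₁
  have hF'n : ‖F'‖ ≤ 5 * s * ρ := hF'def ▸ norm_upow_sub_one_sub_le hR' hρ hs0 hs1
  have hFF : ‖F' - F‖ ≤ 7 * s * ρ * ‖R' - R‖ := hFdef ▸ hF'def ▸ norm_upow_rem_sub_le hR hR' hρ hs0 hs1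
  have hb₀ : ‖(b₀ : 𝔸)‖ = 1 := CStarRing.norm_of_mem_unitary (mem_unitaryUnits.mp h₀)
  rw [hid]
  have hA : ‖(1 - s) • ((b₀' : 𝔸) - b₀) + s • ((b₁' : 𝔸) - b₁)‖ ≤ (1 - s) * ‖(b₀' : 𝔸) - b₀‖ + s * ‖(b₁' : 𝔸) - b₁‖ := by
    refine (norm_add_le _ _).trans (add_le_add ?_ ?_)
    · rw [norm_smul, Real.norm_eq_abs, abs_of_nonneg (by linarith)]
    · rw [norm_smul, Real.norm_eq_abs, abs_of_nonneg hs0]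
  have hB : ‖((b₀' : 𝔸) - b₀) * F' + (b₀ : 𝔸) * (F' - F)‖
      ≤ ‖(b₀' : 𝔸) - b₀‖ * (5 * s * ρ) + 7 * s * ρ * (‖(b₀' : 𝔸) - b₀‖ + ‖(b₁' : 𝔸) - b₁‖) := by
    refine (norm_add_le _ _).trans (add_le_add ?_ ?_)
    · exact (norm_mul_le _ _).trans (mul_le_mul_of_nonneg_left hF'n (norm_nonneg _))
    · rw [CStarRing.norm_mem_unitary_mul _ (mem_unitaryUnits.mp h₀)]
      exact hFF.trans (mul_le_mul_of_nonneg_left hRR (by positivity))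
  have h0 : 0 ≤ ‖(b₁' : 𝔸) - b₁‖ := norm_nonneg _
  calc ‖(1 - s) • ((b₀' : 𝔸) - b₀) + s • ((b₁' : 𝔸) - b₁) + (((b₀' : 𝔸) - b₀) * F' + (b₀ : 𝔸) * (F' - F))‖
      ≤ ((1 - s) * ‖(b₀' : 𝔸) - b₀‖ + s * ‖(b₁' : 𝔸) - b₁‖)
        + (‖(b₀' : 𝔸) - b₀‖ * (5 * s * ρ) + 7 * s * ρ * (‖(b₀' : 𝔸) - b₀‖ + ‖(b₁' : 𝔸) - b₁‖)) :=
        (norm_add_le _ _).trans (add_le_add hA hB)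
    _ ≤ (1 - s) * ‖(b₀' : 𝔸) - b₀‖ + s * ‖(b₁' : 𝔸) - b₁‖ + 12 * s * ρ * (‖(b₀' : 𝔸) - b₀‖ + ‖(b₁' : 𝔸) - b₁‖) := by
        nlinarith [mul_nonneg (mul_nonneg hs0 hρ0) h0, mul_nonneg (mul_nonneg hs0 hρ0) (norm_nonneg ((b₀' : 𝔸) - b₀))]

/-- **Symmetric form**: if both endpoint displacements are `≤ l` then `‖geo′ − geo‖ ≤ (1 + 24sρ)·l ≤ (1 + 24ρ)·l`. [folklore] -/
theorem norm_geo_sub_geo_sharp' {b₀ b₁ b₀' b₁' : 𝔸ˣ} (h₀ : b₀ ∈ unitaryUnits 𝔸) (h₁ : b₁ ∈ unitaryUnits 𝔸)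
    (h₀' : b₀' ∈ unitaryUnits 𝔸) {ρ s l : ℝ} (hρ : ρ ≤ 1 / 4)
    (hb : ‖(b₁ : 𝔸) - b₀‖ ≤ ρ) (hb' : ‖(b₁' : 𝔸) - b₀'‖ ≤ ρ) (hs0 : 0 ≤ s) (hs1 : s ≤ 1)
    (hl₀ : ‖(b₀' : 𝔸) - b₀‖ ≤ l) (hl₁ : ‖(b₁' : 𝔸) - b₁‖ ≤ l) :
    ‖(geo s b₀' b₁' : 𝔸) - geo s b₀ b₁‖ ≤ (1 + 24 * s * ρ) * l := by
  have h := norm_geo_sub_geo_sharp h₀ h₁ h₀' hρ hb hb' hs0 hs1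
  have hρ0 : 0 ≤ ρ := (norm_nonneg _).trans hb
  have hl0 : 0 ≤ l := (norm_nonneg _).trans hl₀
  calc ‖(geo s b₀' b₁' : 𝔸) - geo s b₀ b₁‖
      ≤ (1 - s) * ‖(b₀' : 𝔸) - b₀‖ + s * ‖(b₁' : 𝔸) - b₁‖ + 12 * s * ρ * (‖(b₀' : 𝔸) - b₀‖ + ‖(b₁' : 𝔸) - b₁‖) := h
    _ ≤ (1 - s) * l + s * l + 12 * s * ρ * (l + l) := by gcongr
    _ = (1 + 24 * s * ρ) * l := by ring

/-- **SHARP SECOND-DIFFERENCE BOUND**: over a lattice parallelogram `i = 1..4` of unitary endpoint pairs `(b₀ᵢ, b₁ᵢ)` with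
`‖b₁ᵢ − b₀ᵢ‖ ≤ ρ ≤ 1∕4`, sides `≤ l` (direction `μ`) and `≤ m` (direction `τ`) for both endpoints, and endpoint second
differences `‖pg b₀‖, ‖pg b₁‖ ≤ σ`: for `0 ≤ s ≤ 1`,
`‖pg (geo s b₀ b₁)‖ ≤ σ + s·(53ρ·σ + 115·l·m)` — `pg` of the affine part is `(1−s)pg b₀ + s·pg b₁` EXACTLY, the remainder
`b₀·F_s(b₀⁻¹b₁)` is handled by the product rule and §1. [folklore] -/
theorem norm_pg_geo_le {c₁ c₂ c₃ c₄ d₁ d₂ d₃ d₄ : 𝔸ˣ}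
    (hc₁ : c₁ ∈ unitaryUnits 𝔸) (hc₂ : c₂ ∈ unitaryUnits 𝔸) (hc₃ : c₃ ∈ unitaryUnits 𝔸) (hc₄ : c₄ ∈ unitaryUnits 𝔸)
    (hd₁ : d₁ ∈ unitaryUnits 𝔸) (hd₂ : d₂ ∈ unitaryUnits 𝔸) (hd₃ : d₃ ∈ unitaryUnits 𝔸) (hd₄ : d₄ ∈ unitaryUnits 𝔸)
    {ρ l m σ s : ℝ} (hρ : ρ ≤ 1 / 4) (hs0 : 0 ≤ s) (hs1 : s ≤ 1)
    (hr₁ : ‖(d₁ : 𝔸) - c₁‖ ≤ ρ) (hr₂ : ‖(d₂ : 𝔸) - c₂‖ ≤ ρ) (hr₃ : ‖(d₃ : 𝔸) - c₃‖ ≤ ρ) (hr₄ : ‖(d₄ : 𝔸) - c₄‖ ≤ ρ)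
    (hc12 : ‖(c₂ : 𝔸) - c₁‖ ≤ l) (hc34 : ‖(c₄ : 𝔸) - c₃‖ ≤ l) (hc13 : ‖(c₃ : 𝔸) - c₁‖ ≤ m) (hc24 : ‖(c₄ : 𝔸) - c₂‖ ≤ m)
    (hd12 : ‖(d₂ : 𝔸) - d₁‖ ≤ l) (hd34 : ‖(d₄ : 𝔸) - d₃‖ ≤ l) (hd13 : ‖(d₃ : 𝔸) - d₁‖ ≤ m) (hd24 : ‖(d₄ : 𝔸) - d₂‖ ≤ m)
    (hσc : ‖(c₄ : 𝔸) - c₃ - c₂ + c₁‖ ≤ σ) (hσd : ‖(d₄ : 𝔸) - d₃ - d₂ + d₁‖ ≤ σ) :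
    ‖(geo s c₄ d₄ : 𝔸) - geo s c₃ d₃ - geo s c₂ d₂ + geo s c₁ d₁‖ ≤ σ + s * (53 * ρ * σ + 115 * (l * m)) := by
  have hρ0 : 0 ≤ ρ := (norm_nonneg _).trans hr₁
  have hl0 : 0 ≤ l := (norm_nonneg _).trans hc12
  have hm0 : 0 ≤ m := (norm_nonneg _).trans hc13
  have hσ0 : 0 ≤ σ := (norm_nonneg _).trans hσc
  -- the ratios and remainders at the four corners
  obtain ⟨R₁, hR₁⟩ : ∃ R : 𝔸, R = ((c₁⁻¹ * d₁ : 𝔸ˣ) : 𝔸) := ⟨_, rfl⟩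
  obtain ⟨R₂, hR₂⟩ : ∃ R : 𝔸, R = ((c₂⁻¹ * d₂ : 𝔸ˣ) : 𝔸) := ⟨_, rfl⟩
  obtain ⟨R₃, hR₃⟩ : ∃ R : 𝔸, R = ((c₃⁻¹ * d₃ : 𝔸ˣ) : 𝔸) := ⟨_, rfl⟩
  obtain ⟨R₄, hR₄⟩ : ∃ R : 𝔸, R = ((c₄⁻¹ * d₄ : 𝔸ˣ) : 𝔸) := ⟨_, rfl⟩
  obtain ⟨F₁, hF₁⟩ : ∃ F : 𝔸, F = upow s R₁ - 1 - s • (R₁ - 1) := ⟨_, rfl⟩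
  obtain ⟨F₂, hF₂⟩ : ∃ F : 𝔸, F = upow s R₂ - 1 - s • (R₂ - 1) := ⟨_, rfl⟩
  obtain ⟨F₃, hF₃⟩ : ∃ F : 𝔸, F = upow s R₃ - 1 - s • (R₃ - 1) := ⟨_, rfl⟩
  obtain ⟨F₄, hF₄⟩ : ∃ F : 𝔸, F = upow s R₄ - 1 - s • (R₄ - 1) := ⟨_, rfl⟩
  have hρR : ∀ {c d : 𝔸ˣ}, c ∈ unitaryUnits 𝔸 → ‖(d : 𝔸) - c‖ ≤ ρ → ‖((c⁻¹ * d : 𝔸ˣ) : 𝔸) - 1‖ ≤ ρ :=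
    fun hc h => norm_ratio_sub_one_le hc h
  have h1 : ‖R₁ - 1‖ ≤ ρ := hR₁ ▸ hρR hc₁ hr₁
  have h2 : ‖R₂ - 1‖ ≤ ρ := hR₂ ▸ hρR hc₂ hr₂
  have h3 : ‖R₃ - 1‖ ≤ ρ := hR₃ ▸ hρR hc₃ hr₃
  have h4 : ‖R₄ - 1‖ ≤ ρ := hR₄ ▸ hρR hc₄ hr₄
  -- exact identity: `pg geo = ((1−s) pg c + s pg d) + pg (c·F)`
  have hid : (geo s c₄ d₄ : 𝔸) - geo s c₃ d₃ - geo s c₂ d₂ + geo s c₁ d₁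
      = ((1 - s) • ((c₄ : 𝔸) - c₃ - c₂ + c₁) + s • ((d₄ : 𝔸) - d₃ - d₂ + d₁))
        + ((c₄ : 𝔸) * F₄ - (c₃ : 𝔸) * F₃ - (c₂ : 𝔸) * F₂ + (c₁ : 𝔸) * F₁) := by
    rw [geo_eq_affine_add, geo_eq_affine_add, geo_eq_affine_add, geo_eq_affine_add, ← hR₁, ← hR₂, ← hR₃, ← hR₄,
      ← hF₁, ← hF₂, ← hF₃, ← hF₄, sub_smul, one_smul]
    simp only [smul_sub, smul_add]
    abel
  -- sides and second difference of the ratio `R = c⁻¹ d` (product rule; inverses of unitaries are adjoints)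
  have hinv : ∀ {u v : 𝔸ˣ} {t : ℝ}, u ∈ unitaryUnits 𝔸 → v ∈ unitaryUnits 𝔸 → ‖(u : 𝔸) - v‖ ≤ t →
      ‖((u⁻¹ : 𝔸ˣ) : 𝔸) - ((v⁻¹ : 𝔸ˣ) : 𝔸)‖ ≤ t := fun hu hv h => by rw [norm_inv_sub_inv hu hv]; exact h
  have hRsides : ∀ {cA cB dA dB : 𝔸ˣ} {t : ℝ}, cA ∈ unitaryUnits 𝔸 → cB ∈ unitaryUnits 𝔸 → dA ∈ unitaryUnits 𝔸 →
      ‖(cB : 𝔸) - cA‖ ≤ t → ‖(dB : 𝔸) - dA‖ ≤ t →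
      ‖((cB⁻¹ * dB : 𝔸ˣ) : 𝔸) - ((cA⁻¹ * dA : 𝔸ˣ) : 𝔸)‖ ≤ t + t := fun hcA hcB hdA hcc hdd =>
    (norm_ratio_sub_ratio_le (b₀ := _) (b₁ := _) (b₀' := _) (b₁' := _) hcB hcA hdA).trans (add_le_add hcc hdd)
  have hR12 : ‖R₂ - R₁‖ ≤ l + l := hR₁ ▸ hR₂ ▸ hRsides hc₁ hc₂ hd₁ hc12 hd12
  have hR34 : ‖R₄ - R₃‖ ≤ l + l := hR₃ ▸ hR₄ ▸ hRsides hc₃ hc₄ hd₃ hc34 hd34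
  have hR13 : ‖R₃ - R₁‖ ≤ m + m := hR₁ ▸ hR₃ ▸ hRsides hc₁ hc₃ hd₁ hc13 hd13
  have hR24 : ‖R₄ - R₂‖ ≤ m + m := hR₂ ▸ hR₄ ▸ hRsides hc₂ hc₄ hd₂ hc24 hd24
  have hone : ∀ {u : 𝔸ˣ}, u ∈ unitaryUnits 𝔸 → ‖(u : 𝔸)‖ ≤ 1 := fun hu =>
    (CStarRing.norm_of_mem_unitary (mem_unitaryUnits.mp hu)).le
  have hone' : ∀ {u : 𝔸ˣ}, u ∈ unitaryUnits 𝔸 → ‖((u⁻¹ : 𝔸ˣ) : 𝔸)‖ ≤ 1 := fun hu =>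
    hone ((unitaryUnits 𝔸).inv_mem hu)
  -- `pg R` by the product rule on `c⁻¹ · d`
  have hpgR : ‖R₄ - R₃ - R₂ + R₁‖ ≤ σ * 1 + m * l + l * m + 1 * σ := by
    rw [hR₁, hR₂, hR₃, hR₄]
    simp only [Units.val_mul]
    refine norm_pg_mul_le (hone' hc₁) (hone hd₄) (hinv hc₂ hc₁ hc12) (hinv hc₃ hc₁ hc13) hd34 hd24 ?_ hσd
    rw [norm_pg_inv hc₁ hc₂ hc₃ hc₄]; exact hσc
  -- §1 at the four corners
  have hF₄n : ‖F₄‖ ≤ 5 * s * ρ := hF₄ ▸ norm_upow_sub_one_sub_le h4 hρ hs0 hs1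
  have hF34 : ‖F₄ - F₃‖ ≤ 7 * s * ρ * (l + l) :=
    hF₃ ▸ hF₄ ▸ (norm_upow_rem_sub_le h3 h4 hρ hs0 hs1).trans (mul_le_mul_of_nonneg_left hR34 (by positivity))
  have hF24 : ‖F₄ - F₂‖ ≤ 7 * s * ρ * (m + m) :=
    hF₂ ▸ hF₄ ▸ (norm_upow_rem_sub_le h2 h4 hρ hs0 hs1).trans (mul_le_mul_of_nonneg_left hR24 (by positivity))
  have hpgF : ‖F₄ - F₃ - F₂ + F₁‖ ≤ s * (24 * ρ * (σ * 1 + m * l + l * m + 1 * σ) + 24 * ((l + l) * (m + m))) :=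
    hF₁ ▸ hF₂ ▸ hF₃ ▸ hF₄ ▸ norm_pg_upow_rem_le hρ h1 h2 h3 h4 hR12 hR34 hR13 hR24 hpgR hs0 hs1
  -- `pg (c·F)` by the product rule
  have hpgcF : ‖(c₄ : 𝔸) * F₄ - (c₃ : 𝔸) * F₃ - (c₂ : 𝔸) * F₂ + (c₁ : 𝔸) * F₁‖
      ≤ σ * (5 * s * ρ) + m * (7 * s * ρ * (l + l)) + l * (7 * s * ρ * (m + m))
        + 1 * (s * (24 * ρ * (σ * 1 + m * l + l * m + 1 * σ) + 24 * ((l + l) * (m + m)))) :=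
    norm_pg_mul_le (hone hc₁) hF₄n hc12 hc13 hF34 hF24 hσc hpgF
  -- the affine part
  have hA : ‖(1 - s) • ((c₄ : 𝔸) - c₃ - c₂ + c₁) + s • ((d₄ : 𝔸) - d₃ - d₂ + d₁)‖ ≤ (1 - s) * σ + s * σ := by
    refine (norm_add_le _ _).trans (add_le_add ?_ ?_)
    · rw [norm_smul, Real.norm_eq_abs, abs_of_nonneg (by linarith)]
      exact mul_le_mul_of_nonneg_left hσc (by linarith)
    · rw [norm_smul, Real.norm_eq_abs, abs_of_nonneg hs0]
      exact mul_le_mul_of_nonneg_left hσd hs0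
  rw [hid]
  refine (norm_add_le _ _).trans ((add_le_add hA hpgcF).trans ?_)
  have hlm : 0 ≤ l * m := mul_nonneg hl0 hm0
  have h76' : (76 * ρ + 96) * (l * m) ≤ 115 * (l * m) := mul_le_mul_of_nonneg_right (by linarith) hlm
  have h76 : 53 * ρ * σ + (76 * ρ + 96) * (l * m) ≤ 53 * ρ * σ + 115 * (l * m) := by linarith
  have key : (1 - s) * σ + s * σ + (σ * (5 * s * ρ) + m * (7 * s * ρ * (l + l)) + l * (7 * s * ρ * (m + m))
      + 1 * (s * (24 * ρ * (σ * 1 + m * l + l * m + 1 * σ) + 24 * ((l + l) * (m + m)))))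
      = σ + s * (53 * ρ * σ + (76 * ρ + 96) * (l * m)) := by ring
  rw [key]
  have hfin := mul_le_mul_of_nonneg_left h76 hs0
  linarith

end UnitaryGeo

end

end Summit.QuantumFields.BalabanUV.T4Continuum.NE7GeodesicSecondOrder
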